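import Summits.Parity.GeneralizedHardyLittlewood.Theorems.PrimeLevelFamEdgeMomentsBeyondDiagonalDictionaryAtOneBoxError
import Summits.Parity.GeneralizedHardyLittlewood.Theorems.PrimeLevelFamEdgeMomentsBeyondDiagonalTwoOrderWeightBounds
import HarnessLib

/-!
# Route `PrimeLevelFamEdge`, crux K_A `MomentsBeyondDiagonal` (stmt-Parity-20007), line «petersson_layers» v4:
# THE BOX ERROR AT ORDERS `(i, j)` — the Petersson layer tail `r > q⁸` inside the AFE box, with the two-order weight `W_{ij}`

Port of `norm_boxSum_le` (`…DictionaryAtOneBoxError`, p632616; the case `i = j = 0`, weight `W = W₀₀`) to every pair of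
orders: the ONLY change is the weight step — `weight₂_mul_rpow_le`:
`‖(n₁n₂)^{−1/2} W_{ij}(q̂;n₁,n₂)‖ (n₁n₂)^{3/4} ≤ K_{ij} · L_{ij}(q) · q̂³ · n₁^{−5/4} n₂^{−5/4}` in the box `nᵢ ≤ q²`,
`L_{ij}(q) = ((1+log q̂)(1+2 log q))^{i+j}` (from `norm_afeW_le_logsep` at `A = 3/2` and `1 + log n ≤ 1 + 2 log q`), in place of
`W(y) ≤ 12 y^{−3/2}`. Result `norm_boxSum₂_le`: the `(i,j)` box error is `≤ A_P L_{ij}(q) q̂⁻¹` — one of the two estimates the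
general-`Q` identification `stub_identP` needs after `…TwoOrderGap` (the other is the off-box series). Proof only; K_A NOT proved.
-/

noncomputable section

open scoped Real Nat
open Complex Finset Polynomial CongruenceSubgroup MeasureTheory
open Literature.NumberTheory.EllipticCurves.ModularForms
open Literature.NumberTheory.LFunctions

namespace Summit.Parity.GeneralizedHardyLittlewood.Theorems.MomentsBeyondDiagonal.TwoOrderAFE

open Summit.Parity.GeneralizedHardyLittlewood.Theorems.PrimeLevelFamEdgeIdeaDeltas.PeterssonLayers

/-- **The two-order weight in the box**: there is `K ≥ 0` (depending on `i, j` only) such that for `q ≥ 64` and `n₁, n₂` in the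
AFE box, `‖(n₁n₂)^{−1/2} W_{ij}(q̂;n₁,n₂)‖ (n₁n₂)^{3/4} ≤ K ((1+log q̂)(1+2 log q))^{i+j} q̂³ n₁^{−5/4} n₂^{−5/4}`.
[cite: KowalskiMichelVanderKam2000, (22) p. 12 and (15) p. 9] -/
theorem weight₂_mul_rpow_le (i j : ℕ) :
    ∃ K : ℝ, 0 ≤ K ∧ ∀ {q : ℕ} [NeZero q], 64 ≤ q → ∀ {n₁ n₂ : ℕ}, n₁ ∈ afeBox q → n₂ ∈ afeBox q →
      ‖((((n₁ : ℝ) * n₂) ^ (-(1 / 2 : ℝ)) : ℝ) : ℂ) * KMV2000.afeW (KMV2000.qhat q) i j n₁ n₂‖ *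
          (((n₁ : ℝ) * n₂) ^ (3 / 4 : ℝ)) ≤
        K * ((1 + Real.log (KMV2000.qhat q)) * (1 + 2 * Real.log q)) ^ (i + j) * KMV2000.qhat q ^ (3 : ℝ) *
          (((n₁ : ℝ)) ^ (-(5 / 4 : ℝ)) * ((n₂ : ℝ)) ^ (-(5 / 4 : ℝ))) := by
  set K : ℝ := (∫ x in Set.Ioi (0 : ℝ), x ^ (3 / 2 : ℝ) * (Real.exp (-x) * (2 ^ i * (1 + |Real.log x| ^ i)))) *
    ∫ x in Set.Ioi (0 : ℝ), x ^ (3 / 2 : ℝ) * (Real.exp (-x) * (2 ^ j * (1 + |Real.log x| ^ j))) with hK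
  have hK0 : 0 ≤ K :=
    mul_nonneg (setIntegral_nonneg measurableSet_Ioi fun x hx ↦ by have hx : (0 : ℝ) < x := hx; positivity)
      (setIntegral_nonneg measurableSet_Ioi fun x hx ↦ by have hx : (0 : ℝ) < x := hx; positivity)
  refine ⟨K, hK0, fun {q} _ h64 {n₁ n₂} hn₁ hn₂ ↦ ?_⟩
  have hqh1 : 1 < KMV2000.qhat q := one_lt_qhat h64
  have hqh0 : 0 < KMV2000.qhat q := zero_lt_one.trans hqh1
  have h₁ : n₁ ≠ 0 := ne_zero_of_mem_afeBox hn₁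
  have h₂ : n₂ ≠ 0 := ne_zero_of_mem_afeBox hn₂
  have hn₁0 : (0 : ℝ) < n₁ := by exact_mod_cast Nat.pos_of_ne_zero h₁
  have hn₂0 : (0 : ℝ) < n₂ := by exact_mod_cast Nat.pos_of_ne_zero h₂
  have hN : (0 : ℝ) < (n₁ : ℝ) * n₂ := mul_pos hn₁0 hn₂0
  -- `1 + log n ≤ 1 + 2 log q` in the box
  have hlogbox : ∀ {n : ℕ}, n ∈ afeBox q → 1 + Real.log (n : ℝ) ≤ 1 + 2 * Real.log q := by
    intro n hn
    have hn' := Finset.mem_Icc.mp hn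
    have hn0 : (0 : ℝ) < n := by exact_mod_cast hn'.1
    have hle : (n : ℝ) ≤ ((q : ℝ)) ^ 2 := by exact_mod_cast hn'.2
    have := Real.log_le_log hn0 hle
    rw [Real.log_pow] at this
    push_cast at this
    linarith
  have hW := norm_afeW_le_logsep hqh1.le i j (by norm_num : (0 : ℝ) ≤ 3 / 2) h₁ h₂
  have hLq : 0 ≤ 1 + Real.log (KMV2000.qhat q) := by linarith [Real.log_nonneg hqh1.le]
  have hl₁ : 0 ≤ 1 + Real.log (n₁ : ℝ) := by
    linarith [Real.log_nonneg (show (1 : ℝ) ≤ n₁ by exact_mod_cast Nat.one_le_iff_ne_zero.mpr h₁)]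
  have hl₂ : 0 ≤ 1 + Real.log (n₂ : ℝ) := by
    linarith [Real.log_nonneg (show (1 : ℝ) ≤ n₂ by exact_mod_cast Nat.one_le_iff_ne_zero.mpr h₂)]
  have hlogs : (1 + Real.log (KMV2000.qhat q)) ^ (i + j) * (1 + Real.log n₁) ^ i * (1 + Real.log n₂) ^ j ≤
      ((1 + Real.log (KMV2000.qhat q)) * (1 + 2 * Real.log q)) ^ (i + j) := by
    rw [mul_pow, pow_add (1 + 2 * Real.log (q : ℝ))]
    have g₁ : (1 + Real.log (n₁ : ℝ)) ^ i ≤ (1 + 2 * Real.log q) ^ i := pow_le_pow_left₀ hl₁ (hlogbox hn₁) i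
    have g₂ : (1 + Real.log (n₂ : ℝ)) ^ j ≤ (1 + 2 * Real.log q) ^ j := pow_le_pow_left₀ hl₂ (hlogbox hn₂) j
    calc (1 + Real.log (KMV2000.qhat q)) ^ (i + j) * (1 + Real.log n₁) ^ i * (1 + Real.log n₂) ^ j
        = (1 + Real.log (KMV2000.qhat q)) ^ (i + j) * ((1 + Real.log n₁) ^ i * (1 + Real.log n₂) ^ j) := by ring
      _ ≤ (1 + Real.log (KMV2000.qhat q)) ^ (i + j) * ((1 + 2 * Real.log q) ^ i * (1 + 2 * Real.log q) ^ j) :=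
          mul_le_mul_of_nonneg_left (mul_le_mul g₁ g₂ (pow_nonneg hl₂ j) ((pow_nonneg hl₁ i).trans g₁))
            (pow_nonneg hLq _)
  -- exponent algebra: `(n₁n₂)^{-1/2} (q̂²/n₁n₂)^{3/2} (n₁n₂)^{3/4} = q̂³ n₁^{-5/4} n₂^{-5/4}`
  have e1 : (KMV2000.qhat q ^ 2 / ((n₁ : ℝ) * n₂)) ^ (3 / 2 : ℝ) =
      ((n₁ : ℝ) * n₂) ^ (-(3 / 2 : ℝ)) * KMV2000.qhat q ^ (3 : ℝ) := by
    rw [Real.div_rpow (pow_nonneg hqh0.le 2) hN.le, Real.rpow_neg hN.le, div_eq_mul_inv,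
      ← Real.rpow_natCast (KMV2000.qhat q) 2, ← Real.rpow_mul hqh0.le]
    norm_num
    ring
  have e2 : ((n₁ : ℝ) * n₂) ^ (-(1 / 2 : ℝ)) * (((n₁ : ℝ) * n₂) ^ (-(3 / 2 : ℝ))) * ((n₁ : ℝ) * n₂) ^ (3 / 4 : ℝ) =
      ((n₁ : ℝ)) ^ (-(5 / 4 : ℝ)) * ((n₂ : ℝ)) ^ (-(5 / 4 : ℝ)) := by
    rw [← Real.rpow_add hN, ← Real.rpow_add hN, ← Real.mul_rpow hn₁0.le hn₂0.le]; norm_num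
  have hnorm : ‖((((n₁ : ℝ) * n₂) ^ (-(1 / 2 : ℝ)) : ℝ) : ℂ) * KMV2000.afeW (KMV2000.qhat q) i j n₁ n₂‖ =
      ((n₁ : ℝ) * n₂) ^ (-(1 / 2 : ℝ)) * ‖KMV2000.afeW (KMV2000.qhat q) i j n₁ n₂‖ := by
    rw [norm_mul, Complex.norm_real, Real.norm_eq_abs, abs_of_nonneg (Real.rpow_nonneg hN.le _)]
  rw [hnorm]
  have hr0 : 0 ≤ ((n₁ : ℝ) * n₂) ^ (-(1 / 2 : ℝ)) := Real.rpow_nonneg hN.le _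
  have h34 : 0 ≤ ((n₁ : ℝ) * n₂) ^ (3 / 4 : ℝ) := Real.rpow_nonneg hN.le _
  have hy : 0 ≤ (KMV2000.qhat q ^ 2 / ((n₁ : ℝ) * n₂)) ^ (3 / 2 : ℝ) := Real.rpow_nonneg (by positivity) _
  calc ((n₁ : ℝ) * n₂) ^ (-(1 / 2 : ℝ)) * ‖KMV2000.afeW (KMV2000.qhat q) i j n₁ n₂‖ * ((n₁ : ℝ) * n₂) ^ (3 / 4 : ℝ)
      ≤ ((n₁ : ℝ) * n₂) ^ (-(1 / 2 : ℝ)) * (K * (KMV2000.qhat q ^ 2 / ((n₁ : ℝ) * n₂)) ^ (3 / 2 : ℝ) *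
          ((1 + Real.log (KMV2000.qhat q)) * (1 + 2 * Real.log q)) ^ (i + j)) * ((n₁ : ℝ) * n₂) ^ (3 / 4 : ℝ) := by
        refine mul_le_mul_of_nonneg_right (mul_le_mul_of_nonneg_left (hW.trans ?_) hr0) h34
        exact mul_le_mul_of_nonneg_left hlogs (mul_nonneg hK0 hy)
    _ = K * ((1 + Real.log (KMV2000.qhat q)) * (1 + 2 * Real.log q)) ^ (i + j) *
          (((n₁ : ℝ) * n₂) ^ (-(1 / 2 : ℝ)) * (KMV2000.qhat q ^ 2 / ((n₁ : ℝ) * n₂)) ^ (3 / 2 : ℝ) *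
            ((n₁ : ℝ) * n₂) ^ (3 / 4 : ℝ)) := by ring
    _ = K * ((1 + Real.log (KMV2000.qhat q)) * (1 + 2 * Real.log q)) ^ (i + j) *
          (KMV2000.qhat q ^ (3 : ℝ) *
            (((n₁ : ℝ) * n₂) ^ (-(1 / 2 : ℝ)) * (((n₁ : ℝ) * n₂) ^ (-(3 / 2 : ℝ))) * ((n₁ : ℝ) * n₂) ^ (3 / 4 : ℝ))) := by
        rw [e1]; ring
    _ = _ := by rw [e2]; ring

/-- **THE BOX ERROR AT ORDERS `(i,j)`.** For `q` prime `≥ 64` and `0 < Δ' ≤ 3/2` (`M = q̂^{Δ'}`):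
`‖Σ_{n₁,n₂ ≤ q²} (n₁n₂)^{−1/2} W_{ij}(q̂;n₁,n₂) Σ_{m₁,m₂ ≤ M} x x Σ_{d₁,d₂} (Σʰλλ − [δ − Σ_{r ≤ q⁸} K_r])(a,b)‖
≤ A_P ((1+log q̂)(1+2 log q))^{i+j} q̂⁻¹` (port of `norm_boxSum_le`, weight step `weight₂_mul_rpow_le`).
[cite: KowalskiMichelVanderKam2000, (21)–(22) p. 12; KowalskiMichel2000, §2.4.2 p. 312] -/
theorem norm_boxSum₂_le (P : ℝ[X]) (i j : ℕ) :
    ∃ A : ℝ, 0 ≤ A ∧ ∀ (q : ℕ) [NeZero q], q.Prime → 64 ≤ q → ∀ Δ' : ℝ, 0 < Δ' → Δ' ≤ 3 / 2 →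
      ‖∑ n₁ ∈ afeBox q, ∑ n₂ ∈ afeBox q,
          ((((n₁ : ℝ) * n₂) ^ (-(1 / 2 : ℝ)) : ℝ) : ℂ) * KMV2000.afeW (KMV2000.qhat q) i j n₁ n₂ *
          ∑ m₁ ∈ Icc 1 ⌊KMV2000.qhat q ^ Δ'⌋₊, ∑ m₂ ∈ Icc 1 ⌊KMV2000.qhat q ^ Δ'⌋₊,
            (KMV2000.mollifierCoeff P (KMV2000.qhat q ^ Δ') m₁ : ℂ) *
              (KMV2000.mollifierCoeff P (KMV2000.qhat q ^ Δ') m₂ : ℂ) *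
            ∑ d₁ ∈ (Nat.gcd m₁ n₁).divisors, ∑ d₂ ∈ (Nat.gcd m₂ n₂).divisors,
              (KowalskiMichel2000.pet q (m₁ * n₁ / d₁ ^ 2) (m₂ * n₂ / d₂ ^ 2) -
                (diagKernel (m₁ * n₁ / d₁ ^ 2) (m₂ * n₂ / d₂ ^ 2) -
                  ∑ r ∈ Icc 1 (q ^ 8), layerKernel q r (m₁ * n₁ / d₁ ^ 2) (m₂ * n₂ / d₂ ^ 2)))‖ ≤
        A * ((1 + Real.log (KMV2000.qhat q)) * (1 + 2 * Real.log q)) ^ (i + j) * (KMV2000.qhat q)⁻¹ := by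
  obtain ⟨Kw, hKw0, hKw⟩ := weight₂_mul_rpow_le i j
  obtain ⟨A₀, hA₀0, hA₀⟩ := exists_norm_tsum_layerKernel_tail_le
  obtain ⟨C, hC1, hC⟩ :=
    Literature.NumberTheory.Sieve.exists_card_divisors_le_mul_rpow' (by norm_num : (0 : ℝ) < 1 / 20)
  have hC0 : 0 ≤ C := zero_le_one.trans hC1
  set B : ℝ := ∑ i ∈ range (P.natDegree + 1), |P.coeff i| with hBdef
  have hB : ∀ t ∈ Set.Icc (0 : ℝ) 1, |P.eval t| ≤ B := fun t ht ↦ abs_eval_le_sum_abs_coeff P ht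
  have hZs : Summable (fun n : ℕ ↦ ((n : ℝ)) ^ (-(5 / 4 : ℝ))) := Real.summable_nat_rpow.mpr (by norm_num)
  set Z₁ : ℝ := ∑' n : ℕ, ((n : ℝ)) ^ (-(5 / 4 : ℝ)) with hZ₁
  have hZ₁0 : 0 ≤ Z₁ := tsum_nonneg fun n ↦ Real.rpow_nonneg (Nat.cast_nonneg _) _
  refine ⟨A₀ * B ^ 2 * C ^ 2 * Kw * Z₁ ^ 2, by positivity, fun q _ hq h64 Δ' h0 h32 ↦ ?_⟩
  set L : ℝ := ((1 + Real.log (KMV2000.qhat q)) * (1 + 2 * Real.log q)) ^ (i + j) with hLdef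
  obtain ⟨hM1, hM32, hMq⟩ := mollifierLength_facts h64 h0 h32
  have hqh1 : 1 < KMV2000.qhat q := one_lt_qhat h64
  have hqh0 : 0 < KMV2000.qhat q := zero_lt_one.trans hqh1
  have hq0 : (0 : ℝ) < q := by exact_mod_cast hq.pos
  set M : ℝ := KMV2000.qhat q ^ Δ' with hMdef
  set R : ℕ := q ^ 8 with hRdef
  -- the constant in front of `(ab)^{3/4}` for the inner kernel
  set c : ℝ := A₀ * ((q : ℝ)) ^ (-(3 / 2 : ℝ)) * (((R + 1 : ℕ) : ℝ)) ^ (-(2 / 5 : ℝ)) with hcdef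
  have hc0 : 0 ≤ c := by positivity
  -- the inner kernel bound: `‖pet − κ_R‖ ≤ c (ab)^{3/4}`
  have hG : ∀ n₁ n₂ : ℕ, n₁ ≠ 0 → n₂ ≠ 0 →
      ∀ m₁ ∈ Icc 1 ⌊M⌋₊, ∀ m₂ ∈ Icc 1 ⌊M⌋₊, ∀ d₁ ∈ (Nat.gcd m₁ n₁).divisors, ∀ d₂ ∈ (Nat.gcd m₂ n₂).divisors,
      ‖(fun a b ↦ KowalskiMichel2000.pet q a b -
          (diagKernel a b - ∑ r ∈ Icc 1 R, layerKernel q r a b)) (m₁ * n₁ / d₁ ^ 2) (m₂ * n₂ / d₂ ^ 2)‖ ≤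
        c * ((((m₁ * n₁ / d₁ ^ 2 : ℕ) : ℝ)) * ((m₂ * n₂ / d₂ ^ 2 : ℕ) : ℝ)) ^ (3 / 4 : ℝ) := by
    intro n₁ n₂ hn₁ hn₂ m₁ hm₁ m₂ hm₂ d₁ hd₁ d₂ hd₂
    have hm₁' := (Finset.mem_Icc.mp hm₁).1
    have hm₂' := (Finset.mem_Icc.mp hm₂).1
    have ha : 1 ≤ m₁ * n₁ / d₁ ^ 2 := one_le_mul_div_sq hd₁ hm₁' (Nat.one_le_iff_ne_zero.mpr hn₁)
    have hb : 1 ≤ m₂ * n₂ / d₂ ^ 2 := one_le_mul_div_sq hd₂ hm₂' (Nat.one_le_iff_ne_zero.mpr hn₂)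
    simp only
    rw [pet_sub_kernel_eq_neg_tsum hq ha hb R, norm_neg]
    refine (hA₀ q hq _ _ R ha).trans ?_
    have hs := sqrt_gcd_mul_sqrt_le ha hb
    rw [hcdef]
    have : A₀ * Real.sqrt (((m₁ * n₁ / d₁ ^ 2 : ℕ).gcd (m₂ * n₂ / d₂ ^ 2) : ℕ) : ℝ) *
        Real.sqrt (((m₁ * n₁ / d₁ ^ 2 : ℕ) : ℝ) * ((m₂ * n₂ / d₂ ^ 2 : ℕ) : ℝ)) *
        ((q : ℝ)) ^ (-(3 / 2 : ℝ)) * (((R + 1 : ℕ) : ℝ)) ^ (-(2 / 5 : ℝ)) =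
        (A₀ * ((q : ℝ)) ^ (-(3 / 2 : ℝ)) * (((R + 1 : ℕ) : ℝ)) ^ (-(2 / 5 : ℝ))) *
          (Real.sqrt (((m₁ * n₁ / d₁ ^ 2 : ℕ).gcd (m₂ * n₂ / d₂ ^ 2) : ℕ) : ℝ) *
            Real.sqrt (((m₁ * n₁ / d₁ ^ 2 : ℕ) : ℝ) * ((m₂ * n₂ / d₂ ^ 2 : ℕ) : ℝ))) := by ring
    rw [this]
    exact mul_le_mul_of_nonneg_left hs (by positivity)
  -- the mollifier sum `S = Σ_m m^{3/10} ≤ M^{13/10}`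
  set S : ℝ := ∑ m ∈ Icc 1 ⌊M⌋₊, ((m : ℝ)) ^ (3 / 4 - 1 / 2 + 1 / 20 : ℝ) with hSdef
  have hS0 : 0 ≤ S := Finset.sum_nonneg fun m _ ↦ Real.rpow_nonneg (Nat.cast_nonneg _) _
  have hSle : S ≤ M ^ (13 / 10 : ℝ) := by
    have h := sum_Icc_rpow_le (M := M) (e := 3 / 10) hM1.le (by norm_num)
    have e1 : (3 / 4 - 1 / 2 + 1 / 20 : ℝ) = 3 / 10 := by norm_num
    have e2 : (3 / 10 + 1 : ℝ) = 13 / 10 := by norm_num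
    rw [hSdef, e1]; rw [e2] at h; exact h
  -- inner bound at each box point
  have hinner : ∀ n₁ ∈ afeBox q, ∀ n₂ ∈ afeBox q,
      ‖∑ m₁ ∈ Icc 1 ⌊M⌋₊, ∑ m₂ ∈ Icc 1 ⌊M⌋₊,
          (KMV2000.mollifierCoeff P M m₁ : ℂ) * (KMV2000.mollifierCoeff P M m₂ : ℂ) *
          ∑ d₁ ∈ (Nat.gcd m₁ n₁).divisors, ∑ d₂ ∈ (Nat.gcd m₂ n₂).divisors,
            (KowalskiMichel2000.pet q (m₁ * n₁ / d₁ ^ 2) (m₂ * n₂ / d₂ ^ 2) -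
              (diagKernel (m₁ * n₁ / d₁ ^ 2) (m₂ * n₂ / d₂ ^ 2) -
                ∑ r ∈ Icc 1 R, layerKernel q r (m₁ * n₁ / d₁ ^ 2) (m₂ * n₂ / d₂ ^ 2)))‖ ≤
        c * B ^ 2 * C ^ 2 * (((n₁ : ℝ) * n₂) ^ (3 / 4 : ℝ)) * S ^ 2 := by
    intro n₁ hn₁ n₂ hn₂
    have h := norm_mollifierPairSum_le hB hM1 hC (by norm_num : (0 : ℝ) ≤ 3 / 4) hc0 n₁ n₂
      (fun a b ↦ KowalskiMichel2000.pet q a b - (diagKernel a b - ∑ r ∈ Icc 1 R, layerKernel q r a b))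
      (hG n₁ n₂ (ne_zero_of_mem_afeBox hn₁) (ne_zero_of_mem_afeBox hn₂))
    simpa only using h
  -- the weight against `(n₁n₂)^{3/4}`
  have hL0 : 0 ≤ L := by
    have h1 : 0 ≤ Real.log (KMV2000.qhat q) := Real.log_nonneg hqh1.le
    have h2 : 0 ≤ Real.log (q : ℝ) := Real.log_nonneg (by exact_mod_cast hq.one_lt.le)
    positivity
  have hwt : ∀ n₁ ∈ afeBox q, ∀ n₂ ∈ afeBox q,
      ‖((((n₁ : ℝ) * n₂) ^ (-(1 / 2 : ℝ)) : ℝ) : ℂ) * KMV2000.afeW (KMV2000.qhat q) i j n₁ n₂‖ *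
          (((n₁ : ℝ) * n₂) ^ (3 / 4 : ℝ)) ≤
        Kw * L * KMV2000.qhat q ^ (3 : ℝ) * (((n₁ : ℝ)) ^ (-(5 / 4 : ℝ)) * ((n₂ : ℝ)) ^ (-(5 / 4 : ℝ))) :=
    fun n₁ hn₁ n₂ hn₂ ↦ hKw h64 hn₁ hn₂
  -- `Σ_{n ∈ box} n^{-5/4} ≤ Z₁`
  have hbox : ∑ n ∈ afeBox q, ((n : ℝ)) ^ (-(5 / 4 : ℝ)) ≤ Z₁ :=
    hZs.sum_le_tsum (afeBox q) (fun n _ ↦ Real.rpow_nonneg (Nat.cast_nonneg _) _)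
  have hbox0 : 0 ≤ ∑ n ∈ afeBox q, ((n : ℝ)) ^ (-(5 / 4 : ℝ)) :=
    Finset.sum_nonneg fun n _ ↦ Real.rpow_nonneg (Nat.cast_nonneg _) _
  -- assemble the box sum
  have hmain : ‖∑ n₁ ∈ afeBox q, ∑ n₂ ∈ afeBox q,
          ((((n₁ : ℝ) * n₂) ^ (-(1 / 2 : ℝ)) : ℝ) : ℂ) * KMV2000.afeW (KMV2000.qhat q) i j n₁ n₂ *
          ∑ m₁ ∈ Icc 1 ⌊M⌋₊, ∑ m₂ ∈ Icc 1 ⌊M⌋₊,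
            (KMV2000.mollifierCoeff P M m₁ : ℂ) * (KMV2000.mollifierCoeff P M m₂ : ℂ) *
            ∑ d₁ ∈ (Nat.gcd m₁ n₁).divisors, ∑ d₂ ∈ (Nat.gcd m₂ n₂).divisors,
              (KowalskiMichel2000.pet q (m₁ * n₁ / d₁ ^ 2) (m₂ * n₂ / d₂ ^ 2) -
                (diagKernel (m₁ * n₁ / d₁ ^ 2) (m₂ * n₂ / d₂ ^ 2) -
                  ∑ r ∈ Icc 1 R, layerKernel q r (m₁ * n₁ / d₁ ^ 2) (m₂ * n₂ / d₂ ^ 2)))‖ ≤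
        c * B ^ 2 * C ^ 2 * S ^ 2 * (Kw * L * KMV2000.qhat q ^ (3 : ℝ)) * Z₁ ^ 2 := by
    calc _ ≤ ∑ n₁ ∈ afeBox q, ∑ n₂ ∈ afeBox q,
          ‖((((n₁ : ℝ) * n₂) ^ (-(1 / 2 : ℝ)) : ℝ) : ℂ) * KMV2000.afeW (KMV2000.qhat q) i j n₁ n₂‖ *
            (c * B ^ 2 * C ^ 2 * (((n₁ : ℝ) * n₂) ^ (3 / 4 : ℝ)) * S ^ 2) := by
          refine (norm_sum_le _ _).trans (Finset.sum_le_sum fun n₁ hn₁ ↦ ?_)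
          refine (norm_sum_le _ _).trans (Finset.sum_le_sum fun n₂ hn₂ ↦ ?_)
          rw [norm_mul]
          exact mul_le_mul_of_nonneg_left (hinner n₁ hn₁ n₂ hn₂) (norm_nonneg _)
      _ = c * B ^ 2 * C ^ 2 * S ^ 2 * ∑ n₁ ∈ afeBox q, ∑ n₂ ∈ afeBox q,
          ‖((((n₁ : ℝ) * n₂) ^ (-(1 / 2 : ℝ)) : ℝ) : ℂ) * KMV2000.afeW (KMV2000.qhat q) i j n₁ n₂‖ * (((n₁ : ℝ) * n₂) ^ (3 / 4 : ℝ)) := by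
          rw [Finset.mul_sum]
          refine Finset.sum_congr rfl fun n₁ _ ↦ ?_
          rw [Finset.mul_sum]
          refine Finset.sum_congr rfl fun n₂ _ ↦ ?_
          ring
      _ ≤ c * B ^ 2 * C ^ 2 * S ^ 2 * ∑ n₁ ∈ afeBox q, ∑ n₂ ∈ afeBox q,
          Kw * L * KMV2000.qhat q ^ (3 : ℝ) * (((n₁ : ℝ)) ^ (-(5 / 4 : ℝ)) * ((n₂ : ℝ)) ^ (-(5 / 4 : ℝ))) := by
          exact mul_le_mul_of_nonneg_left
            (Finset.sum_le_sum fun n₁ hn₁ ↦ Finset.sum_le_sum fun n₂ hn₂ ↦ hwt n₁ hn₁ n₂ hn₂)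
            (mul_nonneg (mul_nonneg (mul_nonneg hc0 (sq_nonneg _)) (sq_nonneg _)) (sq_nonneg _))
      _ = c * B ^ 2 * C ^ 2 * S ^ 2 * (Kw * L * KMV2000.qhat q ^ (3 : ℝ)) *
          (∑ n ∈ afeBox q, ((n : ℝ)) ^ (-(5 / 4 : ℝ))) ^ 2 := by
          rw [pow_two (∑ n ∈ afeBox q, ((n : ℝ)) ^ (-(5 / 4 : ℝ))), Finset.sum_mul_sum, Finset.mul_sum,
            Finset.mul_sum]
          refine Finset.sum_congr rfl fun n₁ _ ↦ ?_
          rw [Finset.mul_sum, Finset.mul_sum]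
          refine Finset.sum_congr rfl fun n₂ _ ↦ ?_
          ring
      _ ≤ c * B ^ 2 * C ^ 2 * S ^ 2 * (Kw * L * KMV2000.qhat q ^ (3 : ℝ)) * Z₁ ^ 2 := by
          gcongr
  refine hmain.trans ?_
  -- exponent bookkeeping: `c S² q̂³ ≤ A₀ q̂^{-5/2} ≤ A₀ q̂⁻¹`
  have hS2 : S ^ 2 ≤ KMV2000.qhat q ^ (39 / 10 : ℝ) := by
    calc S ^ 2 ≤ (M ^ (13 / 10 : ℝ)) ^ 2 := by gcongr
      _ = KMV2000.qhat q ^ (Δ' * (13 / 5) : ℝ) := by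
          rw [hMdef, ← Real.rpow_natCast, ← Real.rpow_mul (Real.rpow_nonneg hqh0.le _),
            ← Real.rpow_mul hqh0.le]; norm_num
      _ ≤ KMV2000.qhat q ^ (39 / 10 : ℝ) :=
          Real.rpow_le_rpow_of_exponent_le hqh1.le (by nlinarith)
  have hq32 : ((q : ℝ)) ^ (-(3 / 2 : ℝ)) ≤ KMV2000.qhat q ^ (-(3 : ℝ)) := by
    have h := level_rpow_neg_le (q := q) (s := 3 / 2) (by norm_num)
    rw [show (2 * (3 / 2 : ℝ)) = 3 by norm_num] at h
    exact h
  have hR : (((R + 1 : ℕ) : ℝ)) ^ (-(2 / 5 : ℝ)) ≤ KMV2000.qhat q ^ (-(32 / 5 : ℝ)) := by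
    have h1 : ((q : ℝ)) ^ (8 : ℝ) ≤ (((R + 1 : ℕ) : ℝ)) := by
      rw [hRdef]; push_cast
      rw [show ((8 : ℝ)) = ((8 : ℕ) : ℝ) by norm_num, Real.rpow_natCast]
      linarith
    have h2 : (((R + 1 : ℕ) : ℝ)) ^ (-(2 / 5 : ℝ)) ≤ (((q : ℝ)) ^ (8 : ℝ)) ^ (-(2 / 5 : ℝ)) :=
      Real.rpow_le_rpow_of_nonpos (by positivity) h1 (by norm_num)
    refine h2.trans ?_
    rw [← Real.rpow_mul hq0.le, show ((8 : ℝ) * -(2 / 5 : ℝ)) = -(16 / 5 : ℝ) by norm_num]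
    have h3 := level_rpow_neg_le (q := q) (s := 16 / 5) (by norm_num)
    rw [show (2 * (16 / 5 : ℝ)) = 32 / 5 by norm_num] at h3
    exact h3
  have hcS : c * S ^ 2 * (12 * KMV2000.qhat q ^ (3 : ℝ)) ≤ 12 * A₀ * (KMV2000.qhat q)⁻¹ := by
    calc c * S ^ 2 * (12 * KMV2000.qhat q ^ (3 : ℝ))
        ≤ (A₀ * KMV2000.qhat q ^ (-(3 : ℝ)) * KMV2000.qhat q ^ (-(32 / 5 : ℝ))) *
            KMV2000.qhat q ^ (39 / 10 : ℝ) * (12 * KMV2000.qhat q ^ (3 : ℝ)) := by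
          have hcle : c ≤ A₀ * KMV2000.qhat q ^ (-(3 : ℝ)) * KMV2000.qhat q ^ (-(32 / 5 : ℝ)) := by
            rw [hcdef]
            exact mul_le_mul (mul_le_mul_of_nonneg_left hq32 hA₀0) hR (by positivity) (by positivity)
          exact mul_le_mul_of_nonneg_right (mul_le_mul hcle hS2 (sq_nonneg _) (by positivity)) (by positivity)
      _ = 12 * A₀ * KMV2000.qhat q ^ (-(5 / 2 : ℝ)) := by
          have e : KMV2000.qhat q ^ (-(3 : ℝ)) * KMV2000.qhat q ^ (-(32 / 5 : ℝ)) * KMV2000.qhat q ^ (39 / 10 : ℝ) *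
              KMV2000.qhat q ^ (3 : ℝ) = KMV2000.qhat q ^ (-(5 / 2 : ℝ)) := by
            rw [← Real.rpow_add hqh0, ← Real.rpow_add hqh0, ← Real.rpow_add hqh0]; norm_num
          calc (A₀ * KMV2000.qhat q ^ (-(3 : ℝ)) * KMV2000.qhat q ^ (-(32 / 5 : ℝ))) *
                KMV2000.qhat q ^ (39 / 10 : ℝ) * (12 * KMV2000.qhat q ^ (3 : ℝ))
              = 12 * A₀ * (KMV2000.qhat q ^ (-(3 : ℝ)) * KMV2000.qhat q ^ (-(32 / 5 : ℝ)) *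
                  KMV2000.qhat q ^ (39 / 10 : ℝ) * KMV2000.qhat q ^ (3 : ℝ)) := by ring
            _ = _ := by rw [e]
      _ ≤ 12 * A₀ * (KMV2000.qhat q)⁻¹ := by
          have h : KMV2000.qhat q ^ (-(5 / 2 : ℝ)) ≤ (KMV2000.qhat q)⁻¹ := by
            rw [← Real.rpow_neg_one]
            exact Real.rpow_le_rpow_of_exponent_le hqh1.le (by norm_num)
          exact mul_le_mul_of_nonneg_left h (by positivity)
  have hcS' : c * S ^ 2 * KMV2000.qhat q ^ (3 : ℝ) ≤ A₀ * (KMV2000.qhat q)⁻¹ := by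
    have h12 : (0 : ℝ) < 12 := by norm_num
    nlinarith [hcS]
  calc c * B ^ 2 * C ^ 2 * S ^ 2 * (Kw * L * KMV2000.qhat q ^ (3 : ℝ)) * Z₁ ^ 2
      = B ^ 2 * C ^ 2 * Z₁ ^ 2 * Kw * L * (c * S ^ 2 * KMV2000.qhat q ^ (3 : ℝ)) := by ring
    _ ≤ B ^ 2 * C ^ 2 * Z₁ ^ 2 * Kw * L * (A₀ * (KMV2000.qhat q)⁻¹) :=
        mul_le_mul_of_nonneg_left hcS' (by positivity)
    _ = A₀ * B ^ 2 * C ^ 2 * Kw * Z₁ ^ 2 * L * (KMV2000.qhat q)⁻¹ := by ring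


end Summit.Parity.GeneralizedHardyLittlewood.Theorems.MomentsBeyondDiagonal.TwoOrderAFE

end
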